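import Summits.QuantumAdvantage.QuantumAdvantage.Theorems.SteerDialPick

/-!
# SteerDial (10/10): SteerDialLinear8

§LIN8 (theorems) — the general linear splice `spliceLinG` and the GLOBAL linear-test theorems `linLoss8_of_polyLoss3`,
`rotLinLoss8_of_polyLoss3`, `cycPairLinLoss8_of_polyLoss3` (two nonzero coefficients at cyclic distance `≤ 7`) and, by the
pigeonhole `card_le_of_scattered`, `denseLinLoss8_of_polyLoss3`: EVERY linear test with `|supp a| > (n+8)/8`, every residue.

Part 10 of 10 of the prover-side twin of the workshop node «SteerDial» (route `SpreadDial`, node on 29065 `CoverLift3`;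
lineage decomp-qadv-lens-5, generation 7).  Content verbatim from the monolithic twin `tree/SpreadDialSteer.lean` v5
(sha256 in LAND.md, farm rc0 · 0 err · 0 warn · 0 sorry; axioms `propext`/`Classical.choice`/`Quot.sound` for every theorem),
cut at section boundaries to meet the 400-line rule.  No `def … : Prop`, no `instance`, no `notation`.
-/

set_option linter.style.longLine false
set_option linter.dupNamespace false

namespace Summit.QuantumAdvantage.QuantumAdvantage.Theorems.SteerDial

open Finset
open Literature.Computability.QuantumComplexity Literature.Computability.MetaComplexity
open Literature.Computability.QuantumComplexity.RingHLF
open Summit.QuantumAdvantage.AdviceFreeQNC0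
open Summit.QuantumAdvantage.QuantumAdvantage.Theses

/-! ## §LIN8 (continued)  The general linear splice and the global linear-test theorems -/

section LinearG
variable {n : ℕ}

/-- Body part `a|_{[0,n)}` and window part `a|_{[n,n+8)}` of a coefficient vector on `C_{n+8}`. -/
def bodyCoef8 (a : Fin (n + 8) → ZMod 3) : Fin n → ZMod 3 := fun i => a (Fin.castAdd 8 i)
/-- Window part `a|_{[n,n+8)}`. -/
def winCoef8 (a : Fin (n + 8) → ZMod 3) : Fin 8 → ZMod 3 := fun j => a (Fin.natAdd n j)

/-- SteerDial helper `lin_pad8` (lens-5 g7 SteerDial twin; see the enclosing section docstring). -/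
theorem lin_pad8 (a : Fin (n + 8) → ZMod 3) (w : Fin 8 → Bool) (y : Fin n → Bool) :
    lin a (pad w y) = lin (bodyCoef8 a) y + lin (winCoef8 a) w := by
  unfold lin bodyCoef8 winCoef8
  rw [Fin.sum_univ_add]
  simp only [pad_castAdd, pad_natAdd]

/-- The steering word of a coefficient vector: the identity word of length 8 with window residue `r`. -/
def wsel8 (a : Fin (n + 8) → ZMod 3) (r : ZMod 3) : Fin 8 → Bool := wpick (winCoef8 a) r

/-- SteerDial helper `wsel8_idWord` (lens-5 g7 SteerDial twin; see the enclosing section docstring). -/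
theorem wsel8_idWord {a : Fin (n + 8) → ZMod 3}
    (ha : ∃ j₁ j₂ : Fin 8, j₁ < j₂ ∧ a (Fin.natAdd n j₁) ≠ 0 ∧ a (Fin.natAdd n j₂) ≠ 0) (r : ZMod 3) :
    idWord (wsel8 a r) = true :=
  wpick_idWord ha r

/-- SteerDial helper `lin_wsel8` (lens-5 g7 SteerDial twin; see the enclosing section docstring). -/
theorem lin_wsel8 {a : Fin (n + 8) → ZMod 3}
    (ha : ∃ j₁ j₂ : Fin 8, j₁ < j₂ ∧ a (Fin.natAdd n j₁) ≠ 0 ∧ a (Fin.natAdd n j₂) ≠ 0) (r : ZMod 3) :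
    lin (winCoef8 a) (wsel8 a r) = r :=
  lin_wpick ha r

/-- The GENERAL LINEAR SPLICE: at a body pattern `y` with `ℓ_B(y) = ρ` play the fold of `P` along the identity word
`w_{t-ρ}(α)` (pattern-dependent, certified by the structural theorem `wordCert_of_idWord`). -/
def spliceLinG (a : Fin (n + 8) → ZMod 3) (t : ZMod 3) (P : Fin (n + 8) → Smolensky.CubeFn (ZMod 3) (n + 8)) :
    Fin n → Smolensky.CubeFn (ZMod 3) n :=
  fun i => ∑ ρ : ZMod 3, ind (fun y => decide (lin (bodyCoef8 a) y = ρ)) *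
    ind (foldBitG (wsel8 a (t - ρ)) (cα (wsel8 a (t - ρ))) (cβ (wsel8 a (t - ρ))) (ca (wsel8 a (t - ρ)))
      (cb (wsel8 a (t - ρ))) P i)

/-- The steering embedding `y ↦ (y, w_{t - ℓ_B(y)}(α))`. -/
def spliceLinGEmb (a : Fin (n + 8) → ZMod 3) (t : ZMod 3) (y : Fin n → Bool) : Fin (n + 8) → Bool :=
  pad (wsel8 a (t - lin (bodyCoef8 a) y)) y

/-- SteerDial helper `spliceLinG_bits` (lens-5 g7 SteerDial twin; see the enclosing section docstring). -/
theorem spliceLinG_bits (a : Fin (n + 8) → ZMod 3) (t : ZMod 3) (P : Fin (n + 8) → Smolensky.CubeFn (ZMod 3) (n + 8))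
    (y : Fin n → Bool) (i : Fin n) :
    decide (spliceLinG a t P i y = 1) =
      foldOut n (cα (wsel8 a (t - lin (bodyCoef8 a) y))) (cβ (wsel8 a (t - lin (bodyCoef8 a) y)))
        (ca (wsel8 a (t - lin (bodyCoef8 a) y))) (cb (wsel8 a (t - lin (bodyCoef8 a) y)))
        (bits P (spliceLinGEmb a t y)) i := by
  unfold spliceLinG
  rw [Finset.sum_apply, Fintype.sum_eq_single (lin (bodyCoef8 a) y)]
  · rw [Pi.mul_apply, show ind (fun y' : Fin n → Bool => decide (lin (bodyCoef8 a) y' = lin (bodyCoef8 a) y)) y = 1 by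
        simp [ind], one_mul, decide_ind_eq_one]
    rfl
  · intro ρ hρ
    rw [Pi.mul_apply, show ind (fun y' : Fin n → Bool => decide (lin (bodyCoef8 a) y' = ρ)) y = 0 by
      simp only [ind, decide_eq_true_eq]; rw [if_neg (Ne.symm hρ)], zero_mul]

/-- Degree of the general linear splice: `≤ 2 + 18d`. -/
theorem spliceLinG_mem_lowDeg {d : ℕ} (a : Fin (n + 8) → ZMod 3) (t : ZMod 3)
    {P : Fin (n + 8) → Smolensky.CubeFn (ZMod 3) (n + 8)} (hP : ∀ b, P b ∈ Smolensky.lowDeg (ZMod 3) (n + 8) d) (i : Fin n) :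
    spliceLinG a t P i ∈ Smolensky.lowDeg (ZMod 3) n (2 + (2 * 8 + 2) * d) := by
  unfold spliceLinG
  exact Submodule.sum_mem _ fun ρ _ =>
    Smolensky.mul_mem_lowDeg_add (ind_lin_mem_lowDeg (bodyCoef8 a) ρ) (ind_foldBitG_mem_lowDeg _ _ _ _ _ hP i)

/-- The embedding lands exactly in the test `{ℓ_a = t}`. -/
theorem lin_spliceLinGEmb {a : Fin (n + 8) → ZMod 3}
    (ha : ∃ j₁ j₂ : Fin 8, j₁ < j₂ ∧ a (Fin.natAdd n j₁) ≠ 0 ∧ a (Fin.natAdd n j₂) ≠ 0) (t : ZMod 3) (y : Fin n → Bool) :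
    lin a (spliceLinGEmb a t y) = t := by
  unfold spliceLinGEmb
  rw [lin_pad8, lin_wsel8 ha]
  ring

/-- SteerDial helper `spliceLinGEmb_injective` (lens-5 g7 SteerDial twin; see the enclosing section docstring). -/
theorem spliceLinGEmb_injective (a : Fin (n + 8) → ZMod 3) (t : ZMod 3) : Function.Injective (spliceLinGEmb (n := n) a t) := by
  intro y y' h
  funext i
  have := congrFun h (Fin.castAdd 8 i)
  simpa [spliceLinGEmb, pad_castAdd] using this

/-- Loss transport for the general linear splice (certificate from the STRUCTURAL theorem `wordCert_of_idWord`). -/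
theorem loss_transport_linG (hn : 3 ≤ n) {a : Fin (n + 8) → ZMod 3}
    (ha : ∃ j₁ j₂ : Fin 8, j₁ < j₂ ∧ a (Fin.natAdd n j₁) ≠ 0 ∧ a (Fin.natAdd n j₂) ≠ 0) (t : ZMod 3)
    (P : Fin (n + 8) → Smolensky.CubeFn (ZMod 3) (n + 8)) (y : Fin n → Bool)
    (hloss : ¬ RingHLF.Rel y (fun i => decide (spliceLinG a t P i y = 1))) :
    ¬ RingHLF.Rel (spliceLinGEmb a t y) (fun b => decide (P b (spliceLinGEmb a t y) = 1)) := by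
  intro hwin
  apply hloss
  have hf : (fun i => decide (spliceLinG a t P i y = 1)) =
      foldOut n (cα (wsel8 a (t - lin (bodyCoef8 a) y))) (cβ (wsel8 a (t - lin (bodyCoef8 a) y)))
        (ca (wsel8 a (t - lin (bodyCoef8 a) y))) (cb (wsel8 a (t - lin (bodyCoef8 a) y)))
        (bits P (spliceLinGEmb a t y)) := funext fun i => spliceLinG_bits a t P y i
  rw [hf]
  exact rel_fold hn (by norm_num) (wordCert_of_idWord _ (wsel8_idWord ha (t - lin (bodyCoef8 a) y))) y
    (bits P (spliceLinGEmb a t y)) hwin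

/-- SteerDial helper `card_loss_spliceLinG_le` (lens-5 g7 SteerDial twin; see the enclosing section docstring). -/
theorem card_loss_spliceLinG_le (hn : 3 ≤ n) {a : Fin (n + 8) → ZMod 3}
    (ha : ∃ j₁ j₂ : Fin 8, j₁ < j₂ ∧ a (Fin.natAdd n j₁) ≠ 0 ∧ a (Fin.natAdd n j₂) ≠ 0) (t : ZMod 3)
    (P : Fin (n + 8) → Smolensky.CubeFn (ZMod 3) (n + 8)) :
    (univ.filter fun y : Fin n → Bool => ¬ RingHLF.Rel y (fun i => decide (spliceLinG a t P i y = 1))).card ≤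
      (univ.filter fun x : Fin (n + 8) → Bool =>
        lin a x = t ∧ ¬ RingHLF.Rel x (fun b => decide (P b x = 1))).card := by
  refine Finset.card_le_card_of_injOn (spliceLinGEmb a t) (fun y hy => ?_) (fun y _ y' _ h => spliceLinGEmb_injective a t h)
  rw [Finset.mem_coe, Finset.mem_filter] at hy ⊢
  exact ⟨mem_univ _, lin_spliceLinGEmb ha t y, loss_transport_linG hn ha t P y hy.2⟩

/-- **LinLoss8 (PROVED from PolyLoss3) — GLOBAL linear tests with general coefficients.**  For every coefficient vector
`a : C_{n+8} → 𝔽₃` with (at least) two nonzero coefficients in the window `[n, n+8)` and ARBITRARY coefficients on the `n`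
body positions, every `t ∈ 𝔽₃` and every polylog-degree strategy `P` on `C_{n+8}`: the loss set of `P` has mass
`≥ 2^(n+8)/(n+8)^(k+8)` inside `{x : Σᵢ aᵢ[xᵢ] = t}`.  Proof: the general linear splice — steer by the residue of the body
form, fold along the PATTERN-DEPENDENT identity word `w_r(α)` of length 8 given by the residue-completeness theorem `pickOK`,
certificates from `wordCert_of_idWord`, degree `2 + 18d` within the `degree_budgetG 8` budget. -/
theorem linLoss8_of_polyLoss3 (hP : SpreadDial.PolyLoss3) :
    ∃ k : ℕ, ∀ c : ℕ, ∃ n₀ : ℕ, ∀ n ≥ n₀, ∀ P : Fin (n + 8) → Smolensky.CubeFn (ZMod 3) (n + 8),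
      (∀ b, P b ∈ Smolensky.lowDeg (ZMod 3) (n + 8) ((Nat.log 2 (n + 8)) ^ c)) →
        ∀ a : Fin (n + 8) → ZMod 3, (∃ j₁ j₂ : Fin 8, j₁ < j₂ ∧ a (Fin.natAdd n j₁) ≠ 0 ∧ a (Fin.natAdd n j₂) ≠ 0) →
          ∀ t : ZMod 3,
            1 / ((n + 8 : ℕ) : ℝ) ^ k * (2 : ℝ) ^ (n + 8) ≤
              ((univ.filter fun x : Fin (n + 8) → Bool =>
                lin a x = t ∧ ¬ RingHLF.Rel x (fun b => decide (P b x = 1))).card : ℝ) := by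
  obtain ⟨k, hk⟩ := hP
  refine ⟨k + 8, fun c => ?_⟩
  obtain ⟨n₀, hn₀⟩ := hk (2 * c + 1)
  refine ⟨max n₀ (2 ^ (2 * 8 + 4)), fun n hn P hPdeg a ha t => ?_⟩
  have hn₀' : n₀ ≤ n := le_trans (le_max_left _ _) hn
  have hnM : 2 ^ (2 * 8 + 4) ≤ n := le_trans (le_max_right _ _) hn
  have hn3 : 3 ≤ n := le_trans (by norm_num) hnM
  have hSdeg : ∀ i, spliceLinG a t P i ∈ Smolensky.lowDeg (ZMod 3) n ((Nat.log 2 n) ^ (2 * c + 1)) := fun i =>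
    Smolensky.lowDeg_mono (degree_budgetG 8 c n hnM) (spliceLinG_mem_lowDeg a t hPdeg i)
  have hwin := hn₀ n hn₀' (spliceLinG a t P) hSdeg
  have hsum := card_win_add_card_loss (fun y : Fin n → Bool => RingHLF.Rel y (fun i => decide (spliceLinG a t P i y = 1)))
  have hloss : 1 / (n : ℝ) ^ k * (2 : ℝ) ^ n ≤
      ((univ.filter fun y : Fin n → Bool => ¬ RingHLF.Rel y (fun i => decide (spliceLinG a t P i y = 1))).card : ℝ) := by
    have e : (1 - 1 / (n : ℝ) ^ k) * (2 : ℝ) ^ n = (2 : ℝ) ^ n - 1 / (n : ℝ) ^ k * (2 : ℝ) ^ n := by ring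
    linarith
  have htr' : ((univ.filter fun y : Fin n → Bool => ¬ RingHLF.Rel y (fun i => decide (spliceLinG a t P i y = 1))).card : ℝ) ≤
      ((univ.filter fun x : Fin (n + 8) → Bool =>
        lin a x = t ∧ ¬ RingHLF.Rel x (fun b => decide (P b x = 1))).card : ℝ) := by
    exact_mod_cast card_loss_spliceLinG_le hn3 ha t P
  have hnpos : (0 : ℝ) < n := by exact_mod_cast (show 0 < n by omega)
  have hcmp : 1 / ((n + 8 : ℕ) : ℝ) ^ (k + 8) * (2 : ℝ) ^ (n + 8) ≤ 1 / (n : ℝ) ^ k * (2 : ℝ) ^ n := by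
    have hNk : (n : ℝ) ^ k * 256 ≤ ((n + 8 : ℕ) : ℝ) ^ (k + 8) := by
      push_cast
      rw [pow_add]
      have h256 : (256 : ℝ) ≤ ((n : ℝ) + 8) ^ 8 := by
        calc (256 : ℝ) = 2 ^ 8 := by norm_num
          _ ≤ ((n : ℝ) + 8) ^ 8 := pow_le_pow_left₀ (by norm_num) (by linarith) 8
      have hk' : (n : ℝ) ^ k ≤ ((n : ℝ) + 8) ^ k := pow_le_pow_left₀ hnpos.le (by linarith) k
      exact mul_le_mul hk' h256 (by norm_num) (by positivity)
    have hpos : (0 : ℝ) < (n : ℝ) ^ k * 256 := by positivity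
    calc 1 / ((n + 8 : ℕ) : ℝ) ^ (k + 8) * (2 : ℝ) ^ (n + 8)
        ≤ 1 / ((n : ℝ) ^ k * 256) * (2 : ℝ) ^ (n + 8) :=
          mul_le_mul_of_nonneg_right (one_div_le_one_div_of_le hpos hNk) (by positivity)
      _ = 1 / (n : ℝ) ^ k * (2 : ℝ) ^ n := by
          rw [pow_add]
          field_simp
          norm_num
  exact hcmp.trans (hloss.trans htr')

/-- **RotLinLoss8 (PROVED): the same at EVERY ring offset** — every `𝔽₃`-linear test whose coefficient vector has two
nonzero entries among ANY eight cyclically consecutive positions; in particular EVERY linear test `{ℓ_a = t}` with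
`|supp a| > (n+8)/8` (pigeonhole on the cycle), every `t`: `Θ(3^n · n)` global algebraic tests of degree 2. -/
theorem rotLinLoss8_of_polyLoss3 (hP : SpreadDial.PolyLoss3) :
    ∃ k : ℕ, ∀ c : ℕ, ∃ n₀ : ℕ, ∀ n ≥ n₀, ∀ P : Fin (n + 8) → Smolensky.CubeFn (ZMod 3) (n + 8),
      (∀ b, P b ∈ Smolensky.lowDeg (ZMod 3) (n + 8) ((Nat.log 2 (n + 8)) ^ c)) →
        ∀ a : Fin (n + 8) → ZMod 3, (∃ j₁ j₂ : Fin 8, j₁ < j₂ ∧ a (Fin.natAdd n j₁) ≠ 0 ∧ a (Fin.natAdd n j₂) ≠ 0) →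
          ∀ t : ZMod 3, ∀ s : ℕ,
            1 / ((n + 8 : ℕ) : ℝ) ^ k * (2 : ℝ) ^ (n + 8) ≤
              ((univ.filter fun x : Fin (n + 8) → Bool =>
                lin a (rot s x) = t ∧ ¬ RingHLF.Rel x (fun b => decide (P b x = 1))).card : ℝ) := by
  obtain ⟨k, hk⟩ := linLoss8_of_polyLoss3 hP
  refine ⟨k, fun c => ?_⟩
  obtain ⟨n₀, hn₀⟩ := hk c
  refine ⟨n₀, fun n hn P hPdeg a ha t s => ?_⟩
  set s' := (n + 7) * s with hs'
  have hB := hn₀ n hn (rotStrat s s' P) (fun b => rotStrat_mem_lowDeg s s' hPdeg b) a ha t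
  refine hB.trans ?_
  have hss : ∀ y : Fin (n + 8) → Bool, rot s (rot s' y) = y := fun y => by
    rw [RingSymmetry.rot_rot, show s + s' = (n + 8) * s by rw [hs']; ring]
    exact RingSymmetry.rot_mul_self s y
  have hle : (univ.filter fun y : Fin (n + 8) → Bool =>
        lin a y = t ∧ ¬ RingHLF.Rel y (fun b => decide (rotStrat s s' P b y = 1))).card ≤
      (univ.filter fun x : Fin (n + 8) → Bool =>
        lin a (rot s x) = t ∧ ¬ RingHLF.Rel x (fun b => decide (P b x = 1))).card := by
    refine Finset.card_le_card_of_injOn (rot s') (fun y hy => ?_)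
      (fun y _ y' _ h => RingSymmetry.rot_injective s' h)
    rw [Finset.mem_coe, Finset.mem_filter] at hy ⊢
    refine ⟨mem_univ _, by rw [hss]; exact hy.2.1, fun hwin => hy.2.2 ?_⟩
    have e : (fun b => decide (rotStrat s s' P b y = 1)) =
        rot s (fun b => decide (P b (rot s' y) = 1)) := rfl
    rw [e]
    have := (RingSymmetry.rel_rot s (rot s' y) (fun b => decide (P b (rot s' y) = 1))).2 hwin
    rwa [hss] at this
  exact_mod_cast hle

/-- Re-indexing a linear form along a rotation: `ℓ_{a∘shift_s}(rot_s x) = ℓ_a(x)`. -/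
theorem lin_shift_rot {N : ℕ} (a : Fin N → ZMod 3) (s : ℕ) (x : Fin N → Bool) :
    lin (fun i => a (RingSymmetry.shift N s i)) (rot s x) = lin a x := by
  unfold lin
  rw [RingSymmetry.rot_eq_comp]
  exact Fintype.sum_bijective (RingSymmetry.shift N s) ((RingSymmetry.shift_injective s).bijective_of_finite) _ _
    (fun i => rfl)

/-- **CycPairLinLoss8 (PROVED): every `𝔽₃`-linear test with two nonzero coefficients at cyclic distance `≤ 7`, every `t`.**
The intrinsic form of `rotLinLoss8_of_polyLoss3` (no window, no offset): for every `a : C_{n+8} → 𝔽₃` with `a_i ≠ 0 ≠ a_{i+d}`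
for some position `i` and some `1 ≤ d ≤ 7` (cyclically), the loss set of every polylog-degree strategy has `1/poly` mass
inside `{x : Σᵢ aᵢ[xᵢ] = t}`.  By pigeonhole on the cycle this covers EVERY linear test whose coefficient vector has support of
size `> (n+8)/8` — a family of `Θ(n · 3^n)` GLOBAL degree-2 algebraic tests, each depending on unboundedly many coordinates. -/
theorem cycPairLinLoss8_of_polyLoss3 (hP : SpreadDial.PolyLoss3) :
    ∃ k : ℕ, ∀ c : ℕ, ∃ n₀ : ℕ, ∀ n ≥ n₀, ∀ P : Fin (n + 8) → Smolensky.CubeFn (ZMod 3) (n + 8),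
      (∀ b, P b ∈ Smolensky.lowDeg (ZMod 3) (n + 8) ((Nat.log 2 (n + 8)) ^ c)) →
        ∀ a : Fin (n + 8) → ZMod 3,
          (∃ i : Fin (n + 8), ∃ d : ℕ, 1 ≤ d ∧ d ≤ 7 ∧ a i ≠ 0 ∧ a (RingSymmetry.shift (n + 8) d i) ≠ 0) →
            ∀ t : ZMod 3,
              1 / ((n + 8 : ℕ) : ℝ) ^ k * (2 : ℝ) ^ (n + 8) ≤
                ((univ.filter fun x : Fin (n + 8) → Bool =>
                  lin a x = t ∧ ¬ RingHLF.Rel x (fun b => decide (P b x = 1))).card : ℝ) := by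
  obtain ⟨k, hk⟩ := rotLinLoss8_of_polyLoss3 hP
  refine ⟨k, fun c => ?_⟩
  obtain ⟨n₀, hn₀⟩ := hk c
  refine ⟨n₀, fun n hn P hPdeg a ha t => ?_⟩
  obtain ⟨i, d, hd1, hd7, hi, hid⟩ := ha
  set s := i.val + 8 with hs
  have hwin : ∀ j : Fin 8, RingSymmetry.shift (n + 8) s (Fin.natAdd n j) = RingSymmetry.shift (n + 8) j.val i := by
    intro j
    apply Fin.ext
    simp only [RingSymmetry.shift, Fin.val_natAdd]
    rw [show n + j.val + s = (i.val + j.val) + (n + 8) by rw [hs]; ring, Nat.add_mod_right]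
  have h0 : RingSymmetry.shift (n + 8) 0 i = i := by
    apply Fin.ext
    simp only [RingSymmetry.shift, Nat.add_zero]
    exact Nat.mod_eq_of_lt i.isLt
  have ha' : ∃ j₁ j₂ : Fin 8, j₁ < j₂ ∧ (fun i' => a (RingSymmetry.shift (n + 8) s i')) (Fin.natAdd n j₁) ≠ 0 ∧
      (fun i' => a (RingSymmetry.shift (n + 8) s i')) (Fin.natAdd n j₂) ≠ 0 := by
    refine ⟨⟨0, by norm_num⟩, ⟨d, by omega⟩, Fin.mk_lt_mk.mpr (by omega), ?_, ?_⟩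
    · have e : RingSymmetry.shift (n + 8) s (Fin.natAdd n ⟨0, by norm_num⟩) = i := by rw [hwin]; exact h0
      show a (RingSymmetry.shift (n + 8) s (Fin.natAdd n ⟨0, by norm_num⟩)) ≠ 0
      rw [e]; exact hi
    · show a (RingSymmetry.shift (n + 8) s (Fin.natAdd n ⟨d, by omega⟩)) ≠ 0
      rw [hwin]; exact hid
  have h := hn₀ n hn P hPdeg (fun i' => a (RingSymmetry.shift (n + 8) s i')) ha' t s
  refine h.trans (le_of_eq ?_)
  congr 2
  refine Finset.filter_congr (fun x _ => ?_)
  rw [lin_shift_rot]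

/-- The shift by `0` is the identity. -/
theorem shift_zero_id {N : ℕ} (i : Fin N) : RingSymmetry.shift N 0 i = i := by
  apply Fin.ext
  simp only [RingSymmetry.shift, Nat.add_zero]
  exact Nat.mod_eq_of_lt i.isLt

/-- **Pigeonhole on the cycle:** a set of ring positions no two of which are at cyclic distance `1, …, 7` has at most `N/8`
elements (the translates `A + d`, `d < 8`, are pairwise disjoint copies of `A`). -/
theorem card_le_of_scattered {N : ℕ} (A : Finset (Fin N))
    (h : ∀ i ∈ A, ∀ d : ℕ, 1 ≤ d → d ≤ 7 → RingSymmetry.shift N d i ∉ A) : 8 * A.card ≤ N := by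
  classical
  have key : ∀ i ∈ A, ∀ i' ∈ A, ∀ d d' : ℕ, d < 8 → d' < 8 → d ≤ d' →
      RingSymmetry.shift N d i = RingSymmetry.shift N d' i' → d = d' ∧ i = i' := by
    intro i hi i' hi' d d' hd hd' hle he
    have e2 : RingSymmetry.shift N d' i' = RingSymmetry.shift N d (RingSymmetry.shift N (d' - d) i') := by
      rw [RingSymmetry.shift_shift, Nat.sub_add_cancel hle]
    rw [e2] at he
    have hi_eq : i = RingSymmetry.shift N (d' - d) i' := RingSymmetry.shift_injective d he
    by_cases hdd : d = d'
    · subst hdd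
      refine ⟨rfl, ?_⟩
      rw [hi_eq, Nat.sub_self, shift_zero_id]
    · exfalso
      have hmem : RingSymmetry.shift N (d' - d) i' ∈ A := hi_eq ▸ hi
      exact h i' hi' (d' - d) (by omega) (by omega) hmem
  have hinj : Set.InjOn (fun p : Fin N × ℕ => RingSymmetry.shift N p.2 p.1) ↑(A ×ˢ Finset.range 8) := by
    intro p hp q hq hpq
    rw [Finset.mem_coe, Finset.mem_product, Finset.mem_range] at hp hq
    rcases le_total p.2 q.2 with hle | hle
    · obtain ⟨hd, hi⟩ := key p.1 hp.1 q.1 hq.1 p.2 q.2 hp.2 hq.2 hle hpq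
      exact Prod.ext hi hd
    · obtain ⟨hd, hi⟩ := key q.1 hq.1 p.1 hp.1 q.2 p.2 hq.2 hp.2 hle hpq.symm
      exact Prod.ext hi.symm hd.symm
  have hcard := Finset.card_le_card_of_injOn (fun p : Fin N × ℕ => RingSymmetry.shift N p.2 p.1)
    (fun p _ => Finset.mem_univ _) hinj
  rw [Finset.card_product, Finset.card_range, Finset.card_univ, Fintype.card_fin] at hcard
  omega

/-- **DenseLinLoss8 (PROVED): EVERY `𝔽₃`-linear test with more than `(n+8)/8` nonzero coefficients, every residue.**  For every
`a : C_{n+8} → 𝔽₃` with `|supp a| > (n+8)/8` and every `t ∈ 𝔽₃`, the loss set of every polylog-degree strategy has `1/poly` mass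
inside `{x : Σᵢ aᵢ[xᵢ] = t}` — by the pigeonhole `card_le_of_scattered` two support points are at cyclic distance `≤ 7`, and
`cycPairLinLoss8_of_polyLoss3` applies.  A family of `Θ(3^{n+8})` GLOBAL degree-2 algebraic tests (all but an exponentially small
fraction of all linear tests), none of them a junta, none invariant under the symmetries of the loss set. -/
theorem denseLinLoss8_of_polyLoss3 (hP : SpreadDial.PolyLoss3) :
    ∃ k : ℕ, ∀ c : ℕ, ∃ n₀ : ℕ, ∀ n ≥ n₀, ∀ P : Fin (n + 8) → Smolensky.CubeFn (ZMod 3) (n + 8),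
      (∀ b, P b ∈ Smolensky.lowDeg (ZMod 3) (n + 8) ((Nat.log 2 (n + 8)) ^ c)) →
        ∀ a : Fin (n + 8) → ZMod 3, n + 8 < 8 * (univ.filter fun i : Fin (n + 8) => a i ≠ 0).card →
          ∀ t : ZMod 3,
            1 / ((n + 8 : ℕ) : ℝ) ^ k * (2 : ℝ) ^ (n + 8) ≤
              ((univ.filter fun x : Fin (n + 8) → Bool =>
                lin a x = t ∧ ¬ RingHLF.Rel x (fun b => decide (P b x = 1))).card : ℝ) := by
  obtain ⟨k, hk⟩ := cycPairLinLoss8_of_polyLoss3 hP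
  refine ⟨k, fun c => ?_⟩
  obtain ⟨n₀, hn₀⟩ := hk c
  refine ⟨n₀, fun n hn P hPdeg a hdense t => hn₀ n hn P hPdeg a ?_ t⟩
  by_contra hno
  push Not at hno
  have hsc := card_le_of_scattered (univ.filter fun i : Fin (n + 8) => a i ≠ 0) (fun i hi d hd1 hd7 hmem => by
    rw [Finset.mem_filter] at hi hmem
    exact hmem.2 (hno i d hd1 hd7 hi.2))
  omega

end LinearG

end Summit.QuantumAdvantage.QuantumAdvantage.Theorems.SteerDial
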